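import Mathlib
import Summits.RiemannHypothesis.RiemannHypothesis.Theorems.WeilParityOffLineParityDetectionTrialIntegrals
import Summits.RiemannHypothesis.RiemannHypothesis.Theorems.WeilParityOffLineParityDetectionTrialTransforms
import Summits.RiemannHypothesis.RiemannHypothesis.Theorems.WeilParityOffLineParityDetectionTrialDominant
import Literature.NumberTheory.LFunctions.WeilGroundEnergyParitySplit
import Literature.NumberTheory.LFunctions.WeilMellinBounds
import HarnessLib

/-!
# Stub `stub_dominantQuadrupleOddTrial` (TRIAL) of crux `OffLineParityDetection`, line `registered`

Route `WeilParity`, crux `Summit.RiemannHypothesis.RiemannHypothesis.Theses.WeilParity.OffLineParityDetection`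
(item stmt-RiemannHypothesis-15431), line `registered`.  This file proves the registered stub
`stub_dominantQuadrupleOddTrial` BY NAME with the registered signature — the pure real-analysis
heart of the finite-defect case (no zeta facts): if in a finite weighted configuration `(T, w)` a
point `ρ₀` off the line (`Re ρ₀ ≠ 1/2`, `w ρ₀ > 0`) dominates — every `ρ ∈ T` outside the quadruple
`{ρ₀, ρ̄₀, 1 - ρ₀, 1 - ρ̄₀}` has strictly smaller offset `|Re ρ - 1/2| < |Re ρ₀ - 1/2|` — then for
every real `Z` some window `a > 0` carries a real odd Weil test `o` supported in `[-a, a]`,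
nonzero in `L²`, with
`(‖o‖₁ + ‖o″‖₁)² Z - Σ_{ρ∈T} w(ρ) Re ô(ρ)² < -(Σ_{ρ∈T} w(ρ) ∫_{[-a,a]} sinh²((Re ρ - 1/2)t) sin²((Im ρ)t) dt) ∫|o|²`.

## Proof

With `η = |Re ρ₀ - 1/2| > 0`, `γ = Im ρ₀`, `r² = η² + γ²`, the helper files supply, for ONE constant
`C = C(η, γ)` and every phase window `a ≥ 1` (`cos(2γa) = η/r`, `sin(2γa) = γ/r`, `C a ≤ e^{2ηa}`),
the odd trial test `o = χ · sinh(η·) cos(γ·)` with `‖o‖₁ + ‖o″‖₁ ≤ C a e^{ηa}`, `∫|o|² ≤ C a e^{2ηa}`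
and dominant gain `Re ô(ρ⋆)² - x⋆(a) ∫|o|² ≥ e^{4ηa}/C` at `ρ⋆ = 1/2 + η + iγ`
(`…TrialDominant.trial_exists_oddTest`).  The four points of the quadruple of `ρ₀` share the value
`Re ô(ρ)² = Re ô(ρ⋆)²` (real odd `o`: `ô(ρ̄) = conj ô(ρ)`, `ô(1-ρ) = -ô(ρ)`) and the threshold
`x_ρ(a) = x⋆(a)` (`sinh²`, `sin²` are even in the parameters), and `ρ⋆` is one of them; so the
quadruple part of `Σ w (x_ρ ∫|o|² - Re ô²)` is `≤ -w(ρ₀) e^{4ηa}/C`.  A sub-dominant `ρ`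
(`|Re ρ - 1/2| ≤ η' < η`, `η'` the largest sub-dominant offset) costs at most
`w(ρ) (x_ρ ∫|o|² + |ô(ρ)|²) ≤ w(ρ) a² e^{2ηa} e^{2η'a} (2C + C²)` (`|ô(ρ)| ≤ e^{|Re ρ - 1/2| a} ‖o‖₁`,
`x_ρ(a) ≤ 2a e^{2η'a}`), and `(‖o‖₁ + ‖o″‖₁)² Z ≤ |Z| C² a² e^{2ηa}`.  Choosing the phase window with
`K a² < e^{2(η-η')a}` for the relevant constant `K` (`…TrialIntegrals.trial_exists_growth_phase`)
makes the total negative.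
-/

set_option linter.dupNamespace false

noncomputable section

namespace Summit.RiemannHypothesis.RiemannHypothesis.Theorems.WeilParityOffLineParityDetection

open MeasureTheory Set Real
open scoped ComplexConjugate
open Literature.NumberTheory.LFunctions

/-! ## The quadruple of a point -/

/-- The four points `ρ₀, ρ̄₀, 1 - ρ₀, 1 - ρ̄₀` have the same offset `|Re ρ - 1/2|` and the same
`|Im ρ|`. [folklore] -/
theorem trial_quadruple_abs {ρ ρ₀ : ℂ}
    (h : ρ = ρ₀ ∨ ρ = conj ρ₀ ∨ ρ = 1 - ρ₀ ∨ ρ = 1 - conj ρ₀) :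
    |ρ.re - 1 / 2| = |ρ₀.re - 1 / 2| ∧ |ρ.im| = |ρ₀.im| := by
  rcases h with rfl | rfl | rfl | rfl
  · exact ⟨rfl, rfl⟩
  · exact ⟨by rw [Complex.conj_re], by rw [Complex.conj_im, abs_neg]⟩
  · refine ⟨?_, ?_⟩
    · rw [Complex.sub_re, Complex.one_re, show 1 - ρ₀.re - 1 / 2 = -(ρ₀.re - 1 / 2) by ring,
        abs_neg]
    · rw [Complex.sub_im, Complex.one_im, zero_sub, abs_neg]
  · refine ⟨?_, ?_⟩
    · rw [Complex.sub_re, Complex.one_re, Complex.conj_re,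
        show 1 - ρ₀.re - 1 / 2 = -(ρ₀.re - 1 / 2) by ring, abs_neg]
    · rw [Complex.sub_im, Complex.one_im, Complex.conj_im, zero_sub, neg_neg]

/-- For a real odd test `o`, `Re ô(ρ)²` is the same at the four points of a quadruple. [folklore] -/
theorem trial_quadruple_re_sq {o : ℝ → ℂ} (hodd : ∀ t, o (-t) = -o t)
    (hreal : ∀ t, (o t).im = 0) {ρ ρ₀ : ℂ}
    (h : ρ = ρ₀ ∨ ρ = conj ρ₀ ∨ ρ = 1 - ρ₀ ∨ ρ = 1 - conj ρ₀) :
    ((weilMellin o ρ) ^ 2).re = ((weilMellin o ρ₀) ^ 2).re := by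
  rcases h with rfl | rfl | rfl | rfl
  · rfl
  · exact trial_re_sq_weilMellin_conj hreal ρ₀
  · exact trial_re_sq_weilMellin_one_sub hodd ρ₀
  · rw [trial_re_sq_weilMellin_one_sub hodd, trial_re_sq_weilMellin_conj hreal]

/-- The normalised dominant point `ρ⋆ = 1/2 + |Re ρ₀ - 1/2| + i Im ρ₀` lies in the quadruple of
`ρ₀` (it is `ρ₀` if `Re ρ₀ > 1/2` and `1 - ρ̄₀` if `Re ρ₀ < 1/2`). [folklore] -/
theorem trial_star_mem_quadruple {ρ₀ : ℂ} (hne : ρ₀.re ≠ 1 / 2) :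
    (⟨1 / 2 + |ρ₀.re - 1 / 2|, ρ₀.im⟩ : ℂ) = ρ₀ ∨ (⟨1 / 2 + |ρ₀.re - 1 / 2|, ρ₀.im⟩ : ℂ) = conj ρ₀ ∨
      (⟨1 / 2 + |ρ₀.re - 1 / 2|, ρ₀.im⟩ : ℂ) = 1 - ρ₀ ∨
        (⟨1 / 2 + |ρ₀.re - 1 / 2|, ρ₀.im⟩ : ℂ) = 1 - conj ρ₀ := by
  rcases lt_or_gt_of_ne (sub_ne_zero.2 hne) with hlt | hgt
  · refine Or.inr (Or.inr (Or.inr (Complex.ext ?_ ?_)))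
    · rw [abs_of_neg hlt, Complex.sub_re, Complex.one_re, Complex.conj_re]
      ring
    · rw [Complex.sub_im, Complex.one_im, Complex.conj_im, zero_sub, neg_neg]
  · refine Or.inl (Complex.ext ?_ rfl)
    rw [abs_of_pos hgt]
    show 1 / 2 + (ρ₀.re - 1 / 2) = ρ₀.re
    ring

/-- Thresholds agree at points with the same `|Re ρ - 1/2|` and `|Im ρ|`. [folklore] -/
theorem trial_threshold_eq_of_abs {ρ : ℂ} {η γ a : ℝ} (h1 : |ρ.re - 1 / 2| = |η|)
    (h2 : |ρ.im| = |γ|) :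
    ∫ t in Icc (-a) a, Real.sinh ((ρ.re - 1 / 2) * t) ^ 2 * Real.sin (ρ.im * t) ^ 2 =
      ∫ t in Icc (-a) a, Real.sinh (η * t) ^ 2 * Real.sin (γ * t) ^ 2 := by
  rw [trial_threshold_abs, h1, h2, ← trial_threshold_abs]

/-! ## The registered stub -/

/-- Stub **TRIAL** of crux `OffLineParityDetection` (line `registered`), registered signature: the
dominant-quadruple odd trial function.  See the module docstring for the statement and the
mechanism (plateau cut-off of `sinh(η₀t) cos(γ₀t)` at a phase `2γ₀a + arg ≡ 0`, closed-form window
integrals, exponential domination of the dominant quadruple). [folklore] -/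
theorem stub_dominantQuadrupleOddTrial :
    ∀ (T : Finset ℂ) (w : ℂ → ℝ) (ρ₀ : ℂ), ρ₀ ∈ T → ρ₀.re ≠ 1 / 2 → 0 < w ρ₀ →
      (∀ ρ ∈ T, 0 ≤ w ρ) →
      (∀ ρ ∈ T, |ρ.re - 1 / 2| < |ρ₀.re - 1 / 2| ∨ ρ = ρ₀ ∨ ρ = conj ρ₀ ∨ ρ = 1 - ρ₀ ∨
        ρ = 1 - conj ρ₀) →
      ∀ Z : ℝ, ∃ a : ℝ, 0 < a ∧ ∃ o : ℝ → ℂ, IsWeilTest o ∧ tsupport o ⊆ Set.Icc (-a) a ∧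
        (∀ t, o (-t) = -o t) ∧ (∀ t, (o t).im = 0) ∧ 0 < ∫ t, ‖o t‖ ^ 2 ∧
        ((∫ t, ‖o t‖) + ∫ t, ‖deriv (deriv o) t‖) ^ 2 * Z -
            ∑ ρ ∈ T, w ρ * ((weilMellin o ρ) ^ 2).re <
          -(∑ ρ ∈ T, w ρ * ∫ t in Set.Icc (-a) a,
              Real.sinh ((ρ.re - 1 / 2) * t) ^ 2 * Real.sin (ρ.im * t) ^ 2) * ∫ t, ‖o t‖ ^ 2 := by
  intro T w ρ₀ hρ₀T hne hw₀ hw hdom Z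
  classical
  -- the dominant offset and ordinate
  set η : ℝ := |ρ₀.re - 1 / 2| with hη
  have hη0 : 0 < η := abs_pos.2 (sub_ne_zero.2 hne)
  set γ : ℝ := ρ₀.im with hγ
  -- the largest sub-dominant offset `η' < η`
  set V : Finset ℝ := insert 0 ((T.filter fun ρ ↦ |ρ.re - 1 / 2| < η).image fun ρ ↦ |ρ.re - 1 / 2|)
    with hV
  have hVne : V.Nonempty := ⟨0, Finset.mem_insert_self _ _⟩
  set η' : ℝ := V.max' hVne with hη'
  have hη'lt : η' < η := by
    refine (Finset.max'_lt_iff V hVne).2 fun y hy ↦ ?_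
    rcases Finset.mem_insert.1 hy with rfl | hy
    · exact hη0
    · obtain ⟨ρ, hρ, rfl⟩ := Finset.mem_image.1 hy
      exact (Finset.mem_filter.1 hρ).2
  have hη'0 : 0 ≤ η' := Finset.le_max' V 0 (Finset.mem_insert_self _ _)
  have hsub : ∀ ρ ∈ T, |ρ.re - 1 / 2| < η → |ρ.re - 1 / 2| ≤ η' := fun ρ hρ h ↦
    Finset.le_max' V _ (Finset.mem_insert_of_mem
      (Finset.mem_image_of_mem _ (Finset.mem_filter.2 ⟨hρ, h⟩)))
  -- constants and the window
  obtain ⟨C, hC, hpack⟩ := trial_exists_oddTest η γ hη0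
  set W : ℝ := ∑ ρ ∈ T, w ρ with hW
  have hW0 : 0 ≤ W := Finset.sum_nonneg hw
  set K₁ : ℝ := C * (|Z| * C ^ 2 + W * (2 * C + C ^ 2)) / w ρ₀ with hK₁
  have hK₁0 : 0 ≤ K₁ := by positivity
  have hK₁w : K₁ * w ρ₀ = C * (|Z| * C ^ 2 + W * (2 * C + C ^ 2)) := by
    rw [hK₁]
    field_simp
  have hε : 0 < 2 * (η - η') := by linarith
  obtain ⟨a, ha1, hgrow, hcos, hsin⟩ := trial_exists_growth_phase η (2 * (η - η')) γ (K₁ + C) hη0 hε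
  have ha0 : 0 < a := by linarith
  have hexpε : Real.exp (2 * (η - η') * a) ≤ Real.exp (2 * η * a) :=
    Real.exp_le_exp.2 (by nlinarith)
  have hCa : C * a ≤ Real.exp (2 * η * a) := by
    have h1 : C * a ≤ C * a * a := le_mul_of_one_le_right (by positivity) ha1
    have h2 : (K₁ + C) * a ^ 2 = K₁ * a ^ 2 + C * a * a := by ring
    have h3 : 0 ≤ K₁ * a ^ 2 := by positivity
    linarith
  obtain ⟨o, hoW, hsupp, hodd, hreal, hNpos, hK, hNle, hgain⟩ := hpack a ha1 hcos hsin hCa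
  refine ⟨a, ha0, o, hoW, hsupp, hodd, hreal, hNpos, ?_⟩
  -- sizes
  set N : ℝ := ∫ t, ‖o t‖ ^ 2 with hN
  have hN0 : 0 ≤ N := hNpos.le
  set E : ℝ := Real.exp (η * a) with hE
  have hEpos : 0 < E := Real.exp_pos _
  have hE2 : Real.exp (2 * η * a) = E ^ 2 := by
    rw [hE, ← Real.exp_nat_mul]; congr 1; push_cast; ring
  have hE4 : Real.exp (4 * η * a) = E ^ 4 := by
    rw [hE, ← Real.exp_nat_mul]; congr 1; push_cast; ring
  set X : ℝ := Real.exp (2 * η' * a) with hX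
  have hXpos : 0 < X := Real.exp_pos _
  have hX1 : 1 ≤ X := Real.one_le_exp (by positivity)
  have hEX : E ^ 2 = Real.exp (2 * (η - η') * a) * X := by
    rw [← hE2, hX, ← Real.exp_add]; ring_nf
  rw [hE2] at hNle
  rw [hE4] at hgain
  -- the dominant value and threshold
  set Rs : ℝ := ((weilMellin o ⟨1 / 2 + η, γ⟩) ^ 2).re with hRs
  set Ss : ℝ := ∫ t in Icc (-a) a, Real.sinh (η * t) ^ 2 * Real.sin (γ * t) ^ 2 with hSs
  have hgainpos : 0 < Rs - Ss * N := lt_of_lt_of_le (by positivity) hgain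
  have hstar := trial_star_mem_quadruple hne
  have hquadR : ∀ ρ ∈ T, ¬ |ρ.re - 1 / 2| < η → ((weilMellin o ρ) ^ 2).re = Rs := by
    intro ρ hρ hnot
    have hq := (hdom ρ hρ).resolve_left hnot
    rw [trial_quadruple_re_sq hodd hreal hq, ← trial_quadruple_re_sq hodd hreal hstar]
  have hquadS : ∀ ρ ∈ T, ¬ |ρ.re - 1 / 2| < η →
      ∫ t in Icc (-a) a, Real.sinh ((ρ.re - 1 / 2) * t) ^ 2 * Real.sin (ρ.im * t) ^ 2 = Ss := by
    intro ρ hρ hnot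
    obtain ⟨h1, h2⟩ := trial_quadruple_abs ((hdom ρ hρ).resolve_left hnot)
    exact trial_threshold_eq_of_abs (by rw [h1, hη, abs_abs]) (by rw [h2, hγ])
  -- the sub-dominant points
  have hL1 : ∫ t, ‖o t‖ ≤ C * a * E :=
    (le_add_of_nonneg_right (integral_nonneg fun _ ↦ norm_nonneg _)).trans hK
  have hsubR : ∀ ρ ∈ T, |ρ.re - 1 / 2| < η → -((weilMellin o ρ) ^ 2).re ≤ X * (C * a * E) ^ 2 := by
    intro ρ hρ hlt
    have h1 := trial_neg_norm_sq_le_re_sq (weilMellin o ρ)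
    have h2 := trial_norm_weilMellin_le o a ρ hoW.1.continuous hsupp
    have h3 : Real.exp (|ρ.re - 1 / 2| * a) ≤ Real.exp (η' * a) :=
      Real.exp_le_exp.2 (mul_le_mul_of_nonneg_right (hsub ρ hρ hlt) ha0.le)
    have h4 : ‖weilMellin o ρ‖ ≤ Real.exp (η' * a) * (C * a * E) :=
      h2.trans (mul_le_mul h3 hL1 (integral_nonneg fun _ ↦ norm_nonneg _) (Real.exp_pos _).le)
    have h5 : ‖weilMellin o ρ‖ ^ 2 ≤ (Real.exp (η' * a) * (C * a * E)) ^ 2 :=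
      pow_le_pow_left₀ (norm_nonneg _) h4 2
    have h6 : (Real.exp (η' * a) * (C * a * E)) ^ 2 = X * (C * a * E) ^ 2 := by
      rw [mul_pow, hX, ← Real.exp_nat_mul]; congr 2; push_cast; ring
    linarith
  have hsubS : ∀ ρ ∈ T, |ρ.re - 1 / 2| < η →
      ∫ t in Icc (-a) a, Real.sinh ((ρ.re - 1 / 2) * t) ^ 2 * Real.sin (ρ.im * t) ^ 2 ≤
        2 * a * X := by
    intro ρ hρ hlt
    refine (trial_threshold_le _ _ ha0.le).trans ?_
    rw [hX]
    gcongr 2 * a * Real.exp ?_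
    exact mul_le_mul_of_nonneg_right (mul_le_mul_of_nonneg_left (hsub ρ hρ hlt) (by norm_num))
      ha0.le
  have hterm : ∀ ρ ∈ T, |ρ.re - 1 / 2| < η →
      w ρ * ((∫ t in Icc (-a) a, Real.sinh ((ρ.re - 1 / 2) * t) ^ 2 * Real.sin (ρ.im * t) ^ 2) * N -
        ((weilMellin o ρ) ^ 2).re) ≤ w ρ * (a ^ 2 * E ^ 2 * X * (2 * C + C ^ 2)) := by
    intro ρ hρ hlt
    refine mul_le_mul_of_nonneg_left ?_ (hw ρ hρ)
    have hS := hsubS ρ hρ hlt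
    have hR := hsubR ρ hρ hlt
    have hSN : (∫ t in Icc (-a) a, Real.sinh ((ρ.re - 1 / 2) * t) ^ 2 * Real.sin (ρ.im * t) ^ 2) * N ≤
        2 * a * X * (C * a * E ^ 2) :=
      mul_le_mul hS hNle hN0 (by positivity)
    calc _ ≤ 2 * a * X * (C * a * E ^ 2) + X * (C * a * E) ^ 2 := by linarith
      _ = a ^ 2 * E ^ 2 * X * (2 * C + C ^ 2) := by ring
  -- the sum, split along the quadruple
  have hsplit := Finset.sum_filter_add_sum_filter_not T (fun ρ ↦ |ρ.re - 1 / 2| < η)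
    (fun ρ ↦ w ρ * ((∫ t in Icc (-a) a, Real.sinh ((ρ.re - 1 / 2) * t) ^ 2 *
      Real.sin (ρ.im * t) ^ 2) * N - ((weilMellin o ρ) ^ 2).re))
  have hsum_sub : ∑ ρ ∈ T.filter (fun ρ ↦ |ρ.re - 1 / 2| < η),
      w ρ * ((∫ t in Icc (-a) a, Real.sinh ((ρ.re - 1 / 2) * t) ^ 2 * Real.sin (ρ.im * t) ^ 2) * N -
        ((weilMellin o ρ) ^ 2).re) ≤ W * (a ^ 2 * E ^ 2 * X * (2 * C + C ^ 2)) := by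
    calc _ ≤ ∑ ρ ∈ T.filter (fun ρ ↦ |ρ.re - 1 / 2| < η), w ρ * (a ^ 2 * E ^ 2 * X * (2 * C + C ^ 2)) :=
          Finset.sum_le_sum fun ρ hρ ↦ hterm ρ (Finset.mem_filter.1 hρ).1 (Finset.mem_filter.1 hρ).2
      _ ≤ ∑ ρ ∈ T, w ρ * (a ^ 2 * E ^ 2 * X * (2 * C + C ^ 2)) :=
          Finset.sum_le_sum_of_subset_of_nonneg (Finset.filter_subset _ _)
            fun ρ hρ _ ↦ mul_nonneg (hw ρ hρ) (by positivity)
      _ = W * (a ^ 2 * E ^ 2 * X * (2 * C + C ^ 2)) := by rw [hW, Finset.sum_mul]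
  have hsum_quad : ∑ ρ ∈ T.filter (fun ρ ↦ ¬ |ρ.re - 1 / 2| < η),
      w ρ * ((∫ t in Icc (-a) a, Real.sinh ((ρ.re - 1 / 2) * t) ^ 2 * Real.sin (ρ.im * t) ^ 2) * N -
        ((weilMellin o ρ) ^ 2).re) ≤ -(w ρ₀ * (Rs - Ss * N)) := by
    have heq : ∑ ρ ∈ T.filter (fun ρ ↦ ¬ |ρ.re - 1 / 2| < η),
        w ρ * ((∫ t in Icc (-a) a, Real.sinh ((ρ.re - 1 / 2) * t) ^ 2 * Real.sin (ρ.im * t) ^ 2) * N -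
          ((weilMellin o ρ) ^ 2).re) =
        ∑ ρ ∈ T.filter (fun ρ ↦ ¬ |ρ.re - 1 / 2| < η), -(w ρ * (Rs - Ss * N)) :=
      Finset.sum_congr rfl fun ρ hρ ↦ by
        obtain ⟨hρT, hnot⟩ := Finset.mem_filter.1 hρ
        rw [hquadR ρ hρT hnot, hquadS ρ hρT hnot]
        ring
    rw [heq, Finset.sum_neg_distrib, neg_le_neg_iff]
    have hρ₀mem : ρ₀ ∈ T.filter (fun ρ ↦ ¬ |ρ.re - 1 / 2| < η) :=
      Finset.mem_filter.2 ⟨hρ₀T, by rw [← hη]; exact lt_irrefl η⟩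
    exact Finset.single_le_sum (f := fun ρ ↦ w ρ * (Rs - Ss * N))
      (fun ρ hρ ↦ mul_nonneg (hw ρ (Finset.mem_filter.1 hρ).1) hgainpos.le) hρ₀mem
  have hsum : ∑ ρ ∈ T, w ρ * ((∫ t in Icc (-a) a, Real.sinh ((ρ.re - 1 / 2) * t) ^ 2 *
      Real.sin (ρ.im * t) ^ 2) * N - ((weilMellin o ρ) ^ 2).re) ≤
        W * (a ^ 2 * E ^ 2 * X * (2 * C + C ^ 2)) - w ρ₀ * (Rs - Ss * N) := by
    rw [← hsplit]
    linarith only [hsum_sub, hsum_quad]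
  -- rewrite the claim as `K Z + Σ w (x N - Re ô²) < 0`
  have hrw : ∑ ρ ∈ T, w ρ * ((∫ t in Icc (-a) a, Real.sinh ((ρ.re - 1 / 2) * t) ^ 2 *
      Real.sin (ρ.im * t) ^ 2) * N - ((weilMellin o ρ) ^ 2).re) =
        (∑ ρ ∈ T, w ρ * ∫ t in Icc (-a) a, Real.sinh ((ρ.re - 1 / 2) * t) ^ 2 *
          Real.sin (ρ.im * t) ^ 2) * N - ∑ ρ ∈ T, w ρ * ((weilMellin o ρ) ^ 2).re := by
    rw [Finset.sum_mul, ← Finset.sum_sub_distrib]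
    exact Finset.sum_congr rfl fun ρ _ ↦ by ring
  -- sizes of the competitors
  have hKZ : ((∫ t, ‖o t‖) + ∫ t, ‖deriv (deriv o) t‖) ^ 2 * Z ≤ |Z| * (C * a * E) ^ 2 := by
    have h1 : ((∫ t, ‖o t‖) + ∫ t, ‖deriv (deriv o) t‖) ^ 2 ≤ (C * a * E) ^ 2 :=
      pow_le_pow_left₀ (by positivity) hK 2
    calc _ ≤ |((∫ t, ‖o t‖) + ∫ t, ‖deriv (deriv o) t‖) ^ 2 * Z| := le_abs_self _
      _ = ((∫ t, ‖o t‖) + ∫ t, ‖deriv (deriv o) t‖) ^ 2 * |Z| := by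
          rw [abs_mul, abs_of_nonneg (sq_nonneg _)]
      _ ≤ (C * a * E) ^ 2 * |Z| := mul_le_mul_of_nonneg_right h1 (abs_nonneg Z)
      _ = |Z| * (C * a * E) ^ 2 := by ring
  have hZX : |Z| * (C * a * E) ^ 2 ≤ |Z| * (C * a * E) ^ 2 * X :=
    le_mul_of_one_le_right (by positivity) hX1
  -- the exponential domination
  have hgrow' : K₁ * a ^ 2 < Real.exp (2 * (η - η') * a) :=
    lt_of_le_of_lt (mul_le_mul_of_nonneg_right (by linarith) (sq_nonneg a)) hgrow
  have h1 : K₁ * a ^ 2 * X < E ^ 2 := by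
    rw [hEX]
    exact mul_lt_mul_of_pos_right hgrow' hXpos
  have h2 : C * (|Z| * C ^ 2 + W * (2 * C + C ^ 2)) * a ^ 2 * X < w ρ₀ * E ^ 2 := by
    have h := mul_lt_mul_of_pos_right h1 hw₀
    calc C * (|Z| * C ^ 2 + W * (2 * C + C ^ 2)) * a ^ 2 * X = K₁ * a ^ 2 * X * w ρ₀ := by
          rw [← hK₁w]; ring
      _ < E ^ 2 * w ρ₀ := h
      _ = w ρ₀ * E ^ 2 := by ring
  have h3 : (|Z| * C ^ 2 + W * (2 * C + C ^ 2)) * a ^ 2 * X * E ^ 2 < w ρ₀ * (E ^ 4 / C) := by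
    rw [show w ρ₀ * (E ^ 4 / C) = w ρ₀ * E ^ 2 * E ^ 2 / C by ring, lt_div_iff₀ hC]
    have h := mul_lt_mul_of_pos_right h2 (by positivity : (0 : ℝ) < E ^ 2)
    calc (|Z| * C ^ 2 + W * (2 * C + C ^ 2)) * a ^ 2 * X * E ^ 2 * C =
        C * (|Z| * C ^ 2 + W * (2 * C + C ^ 2)) * a ^ 2 * X * E ^ 2 := by ring
      _ < w ρ₀ * E ^ 2 * E ^ 2 := h
  have hgainw : w ρ₀ * (E ^ 4 / C) ≤ w ρ₀ * (Rs - Ss * N) := mul_le_mul_of_nonneg_left hgain hw₀.le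
  -- conclusion
  have hfinal : ((∫ t, ‖o t‖) + ∫ t, ‖deriv (deriv o) t‖) ^ 2 * Z +
      ∑ ρ ∈ T, w ρ * ((∫ t in Icc (-a) a, Real.sinh ((ρ.re - 1 / 2) * t) ^ 2 *
        Real.sin (ρ.im * t) ^ 2) * N - ((weilMellin o ρ) ^ 2).re) < 0 := by
    have hexp : |Z| * (C * a * E) ^ 2 * X + W * (a ^ 2 * E ^ 2 * X * (2 * C + C ^ 2)) =
        (|Z| * C ^ 2 + W * (2 * C + C ^ 2)) * a ^ 2 * X * E ^ 2 := by ring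
    linarith only [hKZ, hZX, hsum, h3, hgainw, hexp]
  rw [hrw] at hfinal
  linarith only [hfinal]

end Summit.RiemannHypothesis.RiemannHypothesis.Theorems.WeilParityOffLineParityDetection

end
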